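import Mathlib
import Literature.Probability.Process.PointStationaryLaw
import Literature.MathematicalPhysics.StatisticalMechanics.LennardJonesClusters
import Summits.AtomisticToContinuum.Crystallization.Theorems.PalmUnimodularRigidityUnimodularEnergyLowerBoundHardCore
import Summits.AtomisticToContinuum.Crystallization.Theorems.ChargedEnergyGap.Negative.FarCopies
import HarnessLib

/-!
# The boundary term of the ball transport vanishes as `R → ∞`

Support file for item `stmt-AtomisticToContinuum-9229` (`UnimodularEnergyLowerBound`, route
`PalmUnimodularRigidity`).  In the mass transport through ball centres `v ∈ B(0,R)`, the root's
attraction towards configuration points OUTSIDE the ball `B(v,R)` is the only error term; averaged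
over the centres it is `∑_{z ∈ S} V_LJ(‖z‖)⁻ · θ_R(z)` with the geometric weight
`θ_R(z) = vol(B(0,R) ∖ B(z,R)) / vol(B(0,R)) ≤ 1 - (1 - ‖z‖/R)³ → 0`.  We prove:

* `measurable_lennardJones`; `measurable_volume_ball_diff` (measurability of `z ↦ vol(B(0,R) ∖ B(z,R))`);
* `volume_ball_diff_div_le`, `tendsto_volume_ball_diff_div`: the weight is at most
  `(R³ - (R-‖z‖)³)/R³` and tends to `0` along `R = n + 1`;
* `setLIntegral_ball_setLIntegral_compl_ball`: the centre-average of the outside attraction equals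
  `∫ V⁻(‖z‖) · vol(B(0,R) ∖ B(z,R)) dμ(z)` for `μ = count|S` (swap of sum and integral);
* `tendsto_lintegral_neg_lennardJones_mul`: for a rooted hard-core configuration the weighted sum
  tends to `0` (dominated convergence against the summable `V⁻` profile,
  `lintegral_ofReal_neg_lennardJones_le`);
* `tendsto_lintegral_lintegral_neg_lennardJones_mul`: and so does its expectation under any finite
  law carried by rooted `δ`-hard-core configurations (dominated convergence with the uniform bound
  `250/6 · δ⁻⁶`), the configuration entering through an s-finite kernel `κ` with `κ μ = μ` there.

All `[folklore]`.
-/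

noncomputable section

namespace Summit.AtomisticToContinuum.Crystallization.Theorems.UnimodularEnergy

open MeasureTheory Metric Set Filter ProbabilityTheory
open scoped ENNReal Topology
open Literature.MathematicalPhysics.StatisticalMechanics Literature.Probability.Process

open Summit.AtomisticToContinuum.Crystallization.Theorems.ChargedEnergyGapNegative (E3)

/-! ### Measurability -/

/-- The Lennard-Jones potential is a measurable function. [folklore] -/
theorem measurable_lennardJones : Measurable lennardJones := by
  unfold lennardJones
  exact ((measurable_inv.pow_const 12).const_mul _).sub ((measurable_inv.pow_const 6).const_mul _)

/-- `z ↦ V_LJ(‖z‖)⁻` (as `ℝ≥0∞`) is measurable. [folklore] -/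
theorem measurable_ofReal_neg_lennardJones_norm :
    Measurable fun z : E3 => ENNReal.ofReal (-lennardJones ‖z‖) :=
  ENNReal.measurable_ofReal.comp (measurable_lennardJones.comp measurable_norm).neg

/-- `z ↦ V_LJ(‖z‖)⁺` (as `ℝ≥0∞`) is measurable. [folklore] -/
theorem measurable_ofReal_lennardJones_norm :
    Measurable fun z : E3 => ENNReal.ofReal (lennardJones ‖z‖) :=
  ENNReal.measurable_ofReal.comp (measurable_lennardJones.comp measurable_norm)

/-- `z ↦ vol(B(0,R) ∖ B(z,R))` is measurable. [folklore] -/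
theorem measurable_volume_ball_diff (R : ℝ) :
    Measurable fun z : E3 => volume (ball (0 : E3) R \ ball z R) := by
  have hs : MeasurableSet {p : E3 × E3 | p.2 ∈ ball (0 : E3) R ∧ p.2 ∉ ball p.1 R} :=
    (measurableSet_lt (measurable_snd.dist measurable_const) measurable_const).inter
      (measurableSet_lt (measurable_snd.dist measurable_fst) measurable_const).compl
  exact measurable_measure_prodMk_left hs

/-! ### The geometric weight `θ_R(z) = vol(B(0,R) ∖ B(z,R)) / vol(B(0,R))` -/

/-- `vol(B(0,R) ∖ B(z,R)) / vol(B(0,R)) ≤ (R³ - (R - ‖z‖)³)/R³` for `‖z‖ < R`, since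
`B(0, R - ‖z‖) ⊆ B(z,R)`. [folklore] -/
theorem volume_ball_diff_div_le {R : ℝ} {z : E3} (hz : ‖z‖ < R) :
    volume (ball (0 : E3) R \ ball z R) / volume (ball (0 : E3) R) ≤
      ENNReal.ofReal ((R ^ 3 - (R - ‖z‖) ^ 3) / R ^ 3) := by
  have hR : 0 < R := (norm_nonneg z).trans_lt hz
  have hr : 0 < R - ‖z‖ := sub_pos.2 hz
  set c : ℝ≥0∞ := volume (ball (0 : E3) 1) with hc
  have hc0 : c ≠ 0 := (measure_ball_pos volume (0 : E3) one_pos).ne'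
  have hctop : c ≠ ∞ := measure_ball_lt_top.ne
  have hvol : ∀ r : ℝ, 0 < r → volume (ball (0 : E3) r) = ENNReal.ofReal (r ^ 3) * c := fun r hr => by
    rw [Measure.addHaar_ball_of_pos volume (0 : E3) hr, finrank_euclideanSpace_fin]
  have hsub : ball (0 : E3) (R - ‖z‖) ⊆ ball z R := by
    intro w hw
    rw [mem_ball, dist_zero_right] at hw
    rw [mem_ball, dist_eq_norm]
    calc ‖w - z‖ ≤ ‖w‖ + ‖z‖ := norm_sub_le w z
      _ < R := by linarith
  have hdiff : volume (ball (0 : E3) R \ ball z R) ≤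
      volume (ball (0 : E3) R) - volume (ball (0 : E3) (R - ‖z‖)) := by
    calc volume (ball (0 : E3) R \ ball z R)
        ≤ volume (ball (0 : E3) R \ ball (0 : E3) (R - ‖z‖)) :=
          measure_mono (sdiff_le_sdiff_left hsub)
      _ = volume (ball (0 : E3) R) - volume (ball (0 : E3) (R - ‖z‖)) :=
          measure_sdiff (ball_subset_ball (by linarith [norm_nonneg z]))
            measurableSet_ball.nullMeasurableSet measure_ball_lt_top.ne
  calc volume (ball (0 : E3) R \ ball z R) / volume (ball (0 : E3) R)
      ≤ (volume (ball (0 : E3) R) - volume (ball (0 : E3) (R - ‖z‖))) / volume (ball (0 : E3) R) :=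
        ENNReal.div_le_div_right hdiff _
    _ = (ENNReal.ofReal (R ^ 3) * c - ENNReal.ofReal ((R - ‖z‖) ^ 3) * c) /
          (ENNReal.ofReal (R ^ 3) * c) := by rw [hvol R hR, hvol _ hr]
    _ = ENNReal.ofReal (R ^ 3 - (R - ‖z‖) ^ 3) / ENNReal.ofReal (R ^ 3) := by
        rw [← ENNReal.sub_mul fun _ _ => hctop, ← ENNReal.ofReal_sub _ (by positivity),
          ENNReal.mul_div_mul_right _ _ hc0 hctop]
    _ = ENNReal.ofReal ((R ^ 3 - (R - ‖z‖) ^ 3) / R ^ 3) := by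
        rw [ENNReal.ofReal_div_of_pos (by positivity)]

/-- **The weight vanishes at infinity**: `vol(B(0,R) ∖ B(z,R)) / vol(B(0,R)) → 0` as
`R = n + 1 → ∞`, for every `z`. [folklore] -/
theorem tendsto_volume_ball_diff_div (z : E3) :
    Tendsto (fun n : ℕ => volume (ball (0 : E3) ((n : ℝ) + 1) \ ball z ((n : ℝ) + 1)) /
      volume (ball (0 : E3) ((n : ℝ) + 1))) atTop (𝓝 0) := by
  -- the real limit `(R³ - (R - a)³)/R³ = 1 - (1 - a/R)³ → 0`
  have hreal : Tendsto (fun n : ℕ => (((n : ℝ) + 1) ^ 3 - ((n : ℝ) + 1 - ‖z‖) ^ 3) / ((n : ℝ) + 1) ^ 3)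
      atTop (𝓝 0) := by
    have h1 : Tendsto (fun n : ℕ => ‖z‖ / ((n : ℝ) + 1)) atTop (𝓝 0) :=
      tendsto_const_nhds.div_atTop (tendsto_natCast_atTop_atTop.atTop_add tendsto_const_nhds)
    have h2 : Tendsto (fun n : ℕ => 1 - (1 - ‖z‖ / ((n : ℝ) + 1)) ^ 3) atTop
        (𝓝 (1 - (1 - 0) ^ 3)) :=
      tendsto_const_nhds.sub ((tendsto_const_nhds.sub h1).pow 3)
    rw [show (1 - (1 - (0 : ℝ)) ^ 3) = 0 by norm_num] at h2
    refine h2.congr fun n => ?_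
    have hn : (n : ℝ) + 1 ≠ 0 := by positivity
    field_simp
  -- squeeze
  have hbound : ∀ᶠ n : ℕ in atTop,
      volume (ball (0 : E3) ((n : ℝ) + 1) \ ball z ((n : ℝ) + 1)) / volume (ball (0 : E3) ((n : ℝ) + 1)) ≤
        ENNReal.ofReal ((((n : ℝ) + 1) ^ 3 - ((n : ℝ) + 1 - ‖z‖) ^ 3) / ((n : ℝ) + 1) ^ 3) := by
    filter_upwards [eventually_ge_atTop ⌈‖z‖⌉₊] with n hn
    apply volume_ball_diff_div_le
    have h1 : ‖z‖ ≤ (n : ℝ) := (Nat.le_ceil ‖z‖).trans (by exact_mod_cast hn)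
    linarith
  refine tendsto_of_tendsto_of_tendsto_of_le_of_le' tendsto_const_nhds ?_
    (Eventually.of_forall fun n => zero_le) hbound
  rw [← ENNReal.ofReal_zero]
  exact ENNReal.tendsto_ofReal hreal

/-- The weight is at most `1`. [folklore] -/
theorem volume_ball_diff_div_le_one (z : E3) (R : ℝ) :
    volume (ball (0 : E3) R \ ball z R) / volume (ball (0 : E3) R) ≤ 1 :=
  ENNReal.div_le_of_le_mul (by rw [one_mul]; exact measure_mono Set.sdiff_subset)

/-! ### The centre-average of the outside attraction -/

section Swap

variable {δ : ℝ} {S : Set E3}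

/-- **Swapping the sum over points with the integral over centres**: for countable `S` and
`f ≥ 0`, `∫_{B(0,R)} ∫_{B(v,R)ᶜ} f dμ dv = ∫ f(z) · vol(B(0,R) ∖ B(z,R)) dμ(z)`, `μ = count|S`.
[folklore] -/
theorem setLIntegral_ball_setLIntegral_compl_ball (hS : S.Countable) (R : ℝ) (f : E3 → ℝ≥0∞) :
    ∫⁻ v in ball (0 : E3) R, (∫⁻ z in (ball v R)ᶜ, f z ∂((Measure.count : Measure E3).restrict S)) =
      ∫⁻ z, f z * volume (ball (0 : E3) R \ ball z R) ∂((Measure.count : Measure E3).restrict S) := by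
  haveI := hS.to_subtype
  -- the outside indicator as a function of the centre
  have hind : ∀ z v : E3, (ball v R)ᶜ.indicator f z =
      {v : E3 | R ≤ dist z v}.indicator (fun _ => f z) v := by
    intro z v
    by_cases h : dist z v < R
    · have h1 : z ∉ (ball v R)ᶜ := fun h' => h' (mem_ball.2 h)
      have h2 : v ∉ {v : E3 | R ≤ dist z v} := fun h' => (not_le.2 h) h'
      rw [Set.indicator_of_notMem h1, Set.indicator_of_notMem h2]
    · have h1 : z ∈ (ball v R)ᶜ := fun h' => h (mem_ball.1 h')
      have h2 : v ∈ {v : E3 | R ≤ dist z v} := not_lt.1 h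
      rw [Set.indicator_of_mem h1, Set.indicator_of_mem h2]
  have hset : ∀ z : E3, MeasurableSet {v : E3 | R ≤ dist z v} := fun z =>
    measurableSet_le measurable_const (measurable_const.dist measurable_id)
  have hfun : ∀ z : E3, (fun v : E3 => (ball v R)ᶜ.indicator f z) =
      {v : E3 | R ≤ dist z v}.indicator (fun _ => f z) := fun z => funext (hind z)
  have hmeas : ∀ z : S, Measurable fun v : E3 => (ball v R)ᶜ.indicator f (z : E3) := fun z => by
    rw [hfun]
    exact measurable_const.indicator (hset z)
  calc ∫⁻ v in ball (0 : E3) R, (∫⁻ z in (ball v R)ᶜ, f z ∂((Measure.count : Measure E3).restrict S))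
      = ∫⁻ v in ball (0 : E3) R, ∑' z : S, (ball v R)ᶜ.indicator f (z : E3) := by
        refine setLIntegral_congr_fun measurableSet_ball fun v _ => ?_
        rw [← lintegral_indicator measurableSet_ball.compl, lintegral_count_restrict hS]
    _ = ∑' z : S, ∫⁻ v in ball (0 : E3) R, (ball v R)ᶜ.indicator f (z : E3) :=
        lintegral_tsum fun z => (hmeas z).aemeasurable
    _ = ∑' z : S, f z * volume (ball (0 : E3) R \ ball (z : E3) R) := by
        refine tsum_congr fun z => ?_
        rw [show (fun v : E3 => (ball v R)ᶜ.indicator f (z : E3)) =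
            {v : E3 | R ≤ dist (z : E3) v}.indicator (fun _ => f z) from hfun z,
          lintegral_indicator_const (hset z), Measure.restrict_apply (hset z)]
        congr 2
        ext v
        simp only [mem_inter_iff, mem_setOf_eq, Set.mem_sdiff, mem_ball, not_lt]
        rw [dist_comm]
        exact and_comm
    _ = ∫⁻ z, f z * volume (ball (0 : E3) R \ ball z R) ∂((Measure.count : Measure E3).restrict S) :=
        (lintegral_count_restrict hS (fun z => f z * volume (ball (0 : E3) R \ ball z R))).symm

end Swap

/-! ### Dominated convergence: per configuration, then under the law -/

section DCT

variable {δ : ℝ} {S : Set E3}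

/-- **Per configuration**: for a rooted `δ`-hard-core configuration `count|S`,
`∫ V⁻(‖z‖) θ_{n+1}(z) d(count|S) → 0`. [folklore] -/
theorem tendsto_lintegral_neg_lennardJones_mul (hδ : 0 < δ) (h0 : (0 : E3) ∈ S)
    (hsep : ∀ x ∈ S, ∀ y ∈ S, x ≠ y → δ ≤ dist x y) :
    Tendsto (fun n : ℕ => ∫⁻ z, ENNReal.ofReal (-lennardJones ‖z‖) *
      (volume (ball (0 : E3) ((n : ℝ) + 1) \ ball z ((n : ℝ) + 1)) / volume (ball (0 : E3) ((n : ℝ) + 1)))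
        ∂((Measure.count : Measure E3).restrict S)) atTop (𝓝 0) := by
  set m : E3 → ℝ≥0∞ := fun z => ENNReal.ofReal (-lennardJones ‖z‖) with hm_def
  have hm : Measurable m := measurable_ofReal_neg_lennardJones_norm
  have hθ : ∀ n : ℕ, Measurable fun z : E3 =>
      volume (ball (0 : E3) ((n : ℝ) + 1) \ ball z ((n : ℝ) + 1)) / volume (ball (0 : E3) ((n : ℝ) + 1)) :=
    fun n => (measurable_volume_ball_diff _).div measurable_const
  have hfin : ∫⁻ z, m z ∂((Measure.count : Measure E3).restrict S) ≠ ∞ := by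
    have h := lintegral_ofReal_neg_lennardJones_le hδ hsep h0
    simp only [sub_zero] at h
    exact (h.trans_lt ENNReal.ofReal_lt_top).ne
  have h := tendsto_lintegral_of_dominated_convergence (μ := (Measure.count : Measure E3).restrict S)
    (F := fun (n : ℕ) (z : E3) => m z *
      (volume (ball (0 : E3) ((n : ℝ) + 1) \ ball z ((n : ℝ) + 1)) / volume (ball (0 : E3) ((n : ℝ) + 1))))
    (f := fun _ => 0) m (fun n => hm.mul (hθ n))
    (fun n => ae_of_all _ fun z => by
      calc m z * (volume (ball (0 : E3) ((n : ℝ) + 1) \ ball z ((n : ℝ) + 1)) /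
            volume (ball (0 : E3) ((n : ℝ) + 1)))
          ≤ m z * 1 := mul_le_mul' le_rfl (volume_ball_diff_div_le_one z _)
        _ = m z := mul_one _)
    hfin
    (ae_of_all _ fun z => by
      have := ENNReal.Tendsto.const_mul (tendsto_volume_ball_diff_div z) (Or.inr ENNReal.ofReal_ne_top)
        (a := m z)
      rwa [mul_zero] at this)
  simpa only [lintegral_zero] using h

variable {P : Measure (Measure E3)}

/-- **Under the law**: for a finite measure `P` carried by rooted `δ`-hard-core configurations and
an s-finite kernel `κ` that is the identity there,
`∫ ∫ V⁻(‖z‖) θ_{n+1}(z) d(κ μ)(z) dP(μ) → 0` (dominated convergence with the uniform bound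
`250/6 · δ⁻⁶`). [folklore] -/
theorem tendsto_lintegral_lintegral_neg_lennardJones_mul (hδ : 0 < δ) [IsFiniteMeasure P]
    (κ : Kernel (Measure E3) E3) [IsSFiniteKernel κ]
    (hκ : ∀ μ : Measure E3, IsRootedHardCore δ μ → κ μ = μ)
    (hcore : ∀ᵐ μ ∂P, IsRootedHardCore δ μ) :
    Tendsto (fun n : ℕ => ∫⁻ μ, (∫⁻ z, ENNReal.ofReal (-lennardJones ‖z‖) *
      (volume (ball (0 : E3) ((n : ℝ) + 1) \ ball z ((n : ℝ) + 1)) / volume (ball (0 : E3) ((n : ℝ) + 1)))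
        ∂(κ μ)) ∂P) atTop (𝓝 0) := by
  set m : E3 → ℝ≥0∞ := fun z => ENNReal.ofReal (-lennardJones ‖z‖) with hm_def
  have hm : Measurable m := measurable_ofReal_neg_lennardJones_norm
  have hθ : ∀ n : ℕ, Measurable fun z : E3 =>
      volume (ball (0 : E3) ((n : ℝ) + 1) \ ball z ((n : ℝ) + 1)) / volume (ball (0 : E3) ((n : ℝ) + 1)) :=
    fun n => (measurable_volume_ball_diff _).div measurable_const
  set C : ℝ≥0∞ := ENNReal.ofReal (250 / 6 * δ⁻¹ ^ 6) with hC
  have h := tendsto_lintegral_of_dominated_convergence (μ := P)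
    (F := fun (n : ℕ) (μ : Measure E3) => ∫⁻ z, m z *
      (volume (ball (0 : E3) ((n : ℝ) + 1) \ ball z ((n : ℝ) + 1)) / volume (ball (0 : E3) ((n : ℝ) + 1)))
        ∂(κ μ))
    (f := fun _ => 0) (fun _ => C) (fun n => (hm.mul (hθ n)).lintegral_kernel)
    (fun n => hcore.mono fun μ hμ => by
      have hκμ := hκ μ hμ
      obtain ⟨S, h0, hsep, rfl⟩ := hμ
      beta_reduce
      rw [hκμ]
      calc ∫⁻ z, m z * (volume (ball (0 : E3) ((n : ℝ) + 1) \ ball z ((n : ℝ) + 1)) /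
              volume (ball (0 : E3) ((n : ℝ) + 1))) ∂((Measure.count : Measure E3).restrict S)
          ≤ ∫⁻ z, m z ∂((Measure.count : Measure E3).restrict S) :=
            lintegral_mono fun z => by
              calc m z * (volume (ball (0 : E3) ((n : ℝ) + 1) \ ball z ((n : ℝ) + 1)) /
                    volume (ball (0 : E3) ((n : ℝ) + 1)))
                  ≤ m z * 1 := mul_le_mul' le_rfl (volume_ball_diff_div_le_one z _)
                _ = m z := mul_one _
        _ ≤ C := by
            have h := lintegral_ofReal_neg_lennardJones_le hδ hsep h0
            simpa only [sub_zero] using h)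
    (by rw [lintegral_const]; exact ENNReal.mul_ne_top ENNReal.ofReal_ne_top (measure_ne_top P _))
    (hcore.mono fun μ hμ => by
      have hκμ := hκ μ hμ
      obtain ⟨S, h0, hsep, rfl⟩ := hμ
      simp only [hκμ]
      exact tendsto_lintegral_neg_lennardJones_mul hδ h0 hsep)
  simpa only [lintegral_zero] using h

end DCT

end Summit.AtomisticToContinuum.Crystallization.Theorems.UnimodularEnergy

end
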